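import Summits.KontsevichZagierPeriods.KontsevichZagierPeriods.Theses.LinRedNormalForm
import Literature.NumberTheory.Transcendental.MZVSimplexRepProofs
import Literature.NumberTheory.Transcendental.GenusZeroPeriodsMZV
import Literature.NumberTheory.Transcendental.SemialgebraicMapsProofs

/-!
# KontsevichZagierPeriods / LinRedNormalForm — `GenusZeroValuesMzv`
# (stmt-KontsevichZagierPeriods-14838)

Route `KontsevichZagierPeriods/LinRedNormalForm`, support item stmt-KontsevichZagierPeriods-14838
(`GenusZeroValuesMzv`): every absolutely convergent genus-zero representation
`r = [Δ_k, P/(∏ tᵢ^{bᵢ} ∏ (1−tᵢ)^{cᵢ} ∏_{i<j} (tᵢ−tⱼ)^{aᵢⱼ})]` (open ordered simplex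
`Δ_k = {1 > t₀ > ⋯ > t_{k−1} > 0}`) has the value of a `ℤ`-combination of MZV word representations
`[Δ_w, q·∏ ω_{εᵢ}(tᵢ)]` (`q ∈ ℚ`; `w = 0` gives the rational constants).

This is the value-level shadow of the crux `DihedralNormalForm` and, mathematically, exactly
F. Brown's theorem that the periods of the moduli spaces `𝔐_{0,n}` are `ℚ`-linear combinations of
multiple zeta values [Brown, Ann. Sci. ÉNS 42 (2009), Thm 1.1, Lemma 7.4, Thm 8.2, Cor 8.3], whose
formalisation (generalised polylogarithms on `𝔐_{0,n}`, pole-free primitives, regularised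
restriction to the faces of the Stasheff polytope) is far beyond the tree. The file therefore
contains:

* `genusZeroValuesMzv_proof` — the item, CONDITIONAL on the named fact
  `Literature.NumberTheory.Transcendental.GenusZeroPeriodsMZV` (file
  `Literature/NumberTheory/Transcendental/GenusZeroPeriodsMZV.lean`) = Brown's theorem as printed
  (Cor 8.3) for one cell in simplicial coordinates: an absolutely convergent integral over the
  standard cell of a regular function on `𝔐_{0,ℓ+3}` lies in `∑_{w ≤ ℓ} 𝒵_w`, the `ℚ`-span of the
  multiple zeta values of weight at most `ℓ`. Glue: integrability and the
  value of `r` are transported along the pointwise description of its integrand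
  (`IntegrableOn.congr_fun`, `setIntegral_congr_fun`); the set of values `KZ.eval m` of elements `m`
  of the additive closure of the MZV word representations is a `ℚ`-submodule of `ℝ` (a word
  representation scaled by `c ∈ ℚ` is again one, `exists_wordRep_smul`), and it contains every
  multiple zeta value by Kontsevich's formula for the simplex representation
  (`KZ.mzvRep`, `KZ.mzvRep_value_holds`), hence every `𝒵_w`;
* `genusZeroValuesMzv_of_dihedralNormalForm` — the remark of the route text that the crux
  `DihedralNormalForm` gives the item at once by soundness of the calculus
  (`KZ.relations_le_ker_eval_holds`).

References: F. Brown, *Multiple zeta values and periods of moduli spaces `𝔐_{0,n}`*, Ann. Sci. ÉNS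
42 (2009) 371–489 (arXiv:math/0606419), Thm 1.1, §2.1, Lemma 7.4, Thm 8.2, Cor 8.3; M. Kontsevich,
D. Zagier, *Periods* (2001), §1.1–1.2; D. Zagier, *Values of zeta functions and their applications*
(1994), §9.
-/

noncomputable section

open MeasureTheory Set MvPolynomial

namespace Summit.KontsevichZagierPeriods.LinRedNormalForm

open Literature.NumberTheory.Transcendental

/-- **Scaling a word representation.** If `s = [Δ_w, q·∏ᵢ ω_{εᵢ}(tᵢ)]` is an MZV word
representation with rational factor `q`, then for every `c ∈ ℚ` there is a word representation
`s' = [Δ_w, (c q)·∏ᵢ ω_{εᵢ}(tᵢ)]` (same domain, integrand `c · s.integrand`) with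
`s'.value = c · s.value`. [Kontsevich–Zagier 2001, §1.1] [folklore] -/
theorem exists_wordRep_smul (c q : ℚ) {w : ℕ} (ε : Fin w → Bool) (s : KZ.IntegralRep w)
    (hdom : s.domain = {t | (∀ i, 0 < t i) ∧ (∀ i, t i < 1) ∧ StrictAnti t})
    (hint : EqOn s.integrand
      (fun t => (q : ℝ) * ∏ i, if ε i then 1 / (1 - t i) else 1 / t i) s.domain) :
    ∃ s' : KZ.IntegralRep w, s'.domain = {t | (∀ i, 0 < t i) ∧ (∀ i, t i < 1) ∧ StrictAnti t} ∧
      EqOn s'.integrand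
        (fun t => ((c * q : ℚ) : ℝ) * ∏ i, if ε i then 1 / (1 - t i) else 1 / t i) s'.domain ∧
      s'.value = (c : ℝ) * s.value := by
  have hc : IsSemialgebraicFunOn ℚ s.domain (fun _ => (c : ℝ)) :=
    (isSemialgebraicFunOn_aeval s.isSemialgebraic_domain (C c)).congr fun t _ => by simp
  refine ⟨{ domain := s.domain
            integrand := fun t => (c : ℝ) * s.integrand t
            isSemialgebraic_domain := s.isSemialgebraic_domain
            isSemialgebraicFunOn_integrand :=
              IsSemialgebraicFunOn.mul_holds hc s.isSemialgebraicFunOn_integrand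
            integrableOn := s.integrableOn.const_mul (c : ℝ) }, hdom, ?_, ?_⟩
  · intro t ht
    show (c : ℝ) * s.integrand t = _
    rw [hint ht]
    push_cast
    ring
  · show ∫ t in s.domain, (c : ℝ) * s.integrand t = (c : ℝ) * s.value
    rw [integral_const_mul]
    rfl

/-- **Additive extension of scaling.** If every generator `x ∈ G` has a partner `y ∈ G` with
`eval y = c · eval x`, then every element of the additive closure of `G` has a partner in the
closure with `c` times its value. [folklore] -/
theorem exists_mem_closure_eval_eq_mul {G : Set KZ.FormalRep} (c : ℚ)
    (hG : ∀ x ∈ G, ∃ y ∈ G, KZ.eval y = (c : ℝ) * KZ.eval x)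
    {m : KZ.FormalRep} (hm : m ∈ AddSubgroup.closure G) :
    ∃ m' ∈ AddSubgroup.closure G, KZ.eval m' = (c : ℝ) * KZ.eval m := by
  induction hm using AddSubgroup.closure_induction with
  | mem x hx =>
    obtain ⟨y, hy, h⟩ := hG x hx
    exact ⟨y, AddSubgroup.subset_closure hy, h⟩
  | zero => exact ⟨0, zero_mem _, by simp⟩
  | add x y _ _ ihx ihy =>
    obtain ⟨m₁, hm₁, h₁⟩ := ihx
    obtain ⟨m₂, hm₂, h₂⟩ := ihy
    exact ⟨m₁ + m₂, add_mem hm₁ hm₂, by rw [map_add, map_add, h₁, h₂, mul_add]⟩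
  | neg x _ ih =>
    obtain ⟨m', hm', h⟩ := ih
    exact ⟨-m', neg_mem hm', by rw [map_neg, map_neg, h, mul_neg]⟩

/-- **`GenusZeroValuesMzv` from Brown's theorem** (item stmt-KontsevichZagierPeriods-14838,
conditional on the named fact `GenusZeroPeriodsMZV` = Brown 2009, Thm 1.1 /
Cor 8.3). Given a genus-zero representation `r` (open ordered simplex, integrand pointwise equal to
`P/(∏ tᵢ^{bᵢ} ∏ (1−tᵢ)^{cᵢ} ∏_{i<j}(tᵢ−tⱼ)^{aᵢⱼ})`), absolute convergence is the field
`r.integrableOn`, transported to the explicit integrand along the pointwise description; Brown's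
theorem puts `r.value` in `∑_{w ≤ k} 𝒵_w`. The values `eval m`, `m` in the additive closure of the
MZV word representations `[Δ_w, q·∏ ω_{εᵢ}(tᵢ)]`, form a `ℚ`-submodule of `ℝ` (closed under
scaling by `exists_wordRep_smul`, extended additively) containing every multiple zeta value
(Kontsevich's formula `KZ.mzvRep_value_holds` for the simplex representation `KZ.mzvRep`, which is
a word representation with `q = 1`), hence containing every `𝒵_w`. [Brown 2009, Thm 1.1, Cor 8.3;
Kontsevich–Zagier 2001, §1.1] [cite: BrownENS2009, Thm 1.1] -/
theorem genusZeroValuesMzv_proof (hBrown : GenusZeroPeriodsMZV) :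
    Summit.KontsevichZagierPeriods.KontsevichZagierPeriods.Theses.LinRedNormalForm.GenusZeroValuesMzv := by
  unfold Summit.KontsevichZagierPeriods.KontsevichZagierPeriods.Theses.LinRedNormalForm.GenusZeroValuesMzv
  intro k r p a b c hdom hint
  -- the generator set: MZV word representations with a rational factor
  set G : Set KZ.FormalRep := {x | ∃ (w : ℕ) (ε : Fin w → Bool) (q : ℚ) (s : KZ.IntegralRep w),
    s.domain = {t | (∀ i, 0 < t i) ∧ (∀ i, t i < 1) ∧ StrictAnti t} ∧
    EqOn s.integrand (fun t => (q : ℝ) * ∏ i, if ε i then 1 / (1 - t i) else 1 / t i) s.domain ∧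
    x = KZ.of s} with hG
  -- generators scale by rationals
  have hscale : ∀ (d : ℚ), ∀ x ∈ G, ∃ y ∈ G, KZ.eval y = (d : ℝ) * KZ.eval x := by
    rintro d x ⟨w, ε, q, s, hsd, hsi, rfl⟩
    obtain ⟨s', hd', hi', hv'⟩ := exists_wordRep_smul d q ε s hsd hsi
    exact ⟨KZ.of s', ⟨w, ε, d * q, s', hd', hi', rfl⟩, by rw [KZ.eval_of, KZ.eval_of, hv']⟩
  -- the ℚ-submodule of values of the additive closure
  let V : Submodule ℚ ℝ :=
    { carrier := {x | ∃ m ∈ AddSubgroup.closure G, KZ.eval m = x}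
      add_mem' := by
        rintro x y ⟨m₁, hm₁, rfl⟩ ⟨m₂, hm₂, rfl⟩
        exact ⟨m₁ + m₂, add_mem hm₁ hm₂, map_add _ _ _⟩
      zero_mem' := ⟨0, zero_mem _, map_zero _⟩
      smul_mem' := by
        rintro d x ⟨m, hm, rfl⟩
        obtain ⟨m', hm', h'⟩ := exists_mem_closure_eval_eq_mul d (hscale d) hm
        exact ⟨m', hm', by rw [h', Rat.smul_def]⟩ }
  -- every multiple zeta value is such a value: Kontsevich's formula for the simplex representation
  have hMZV : ∀ s : List ℕ, MZV.IsAdmissible s → multipleZeta s ∈ V := by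
    intro s hs
    have h₁ := KZ.mzvIntegrand_isSemialgebraicFunOn_holds s
    have h₂ := KZ.mzvIntegrand_integrableOn_holds s hs
    refine ⟨KZ.of (KZ.mzvRep s hs h₁ h₂), AddSubgroup.subset_closure ?_, ?_⟩
    · refine ⟨MZV.weight s, fun i => (MZV.binaryWord s).getD i false, 1, KZ.mzvRep s hs h₁ h₂,
        rfl, ?_, rfl⟩
      intro t _
      show KZ.mzvIntegrand s t = _
      simp only [KZ.mzvIntegrand, KZ.mzvForm, Rat.cast_one, one_mul]
    · rw [KZ.eval_of]
      exact KZ.mzvRep_value_holds s hs h₁ h₂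
  have hspan : (⨆ (w : ℕ) (_ : w ≤ k), mzvSpace w) ≤ V := by
    refine iSup₂_le fun w _ => Submodule.span_le.mpr ?_
    rintro x ⟨s, hs, -, rfl⟩
    exact hMZV s hs
  -- transport absolute convergence and the value of `r` along the pointwise description
  have hmeas : MeasurableSet r.domain := hdom ▸ KZ.measurableSet_openOrderedSimplex k
  have hf := r.integrableOn.congr_fun hint hmeas
  rw [hdom] at hf
  have hv : r.value = ∫ t in r.domain, MvPolynomial.aeval t p /
      ((∏ i, t i ^ b i) * (∏ i, (1 - t i) ^ c i) *
        ∏ i, ∏ j, if i < j then (t i - t j) ^ a i j else 1) :=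
    setIntegral_congr_fun hmeas hint
  rw [hdom] at hv
  obtain ⟨m, hm, hmv⟩ := hspan (hBrown k p a b c hf)
  exact ⟨m, hm, hmv.trans hv.symm⟩

/-- **The crux gives the item** (remark of the route text):
`DihedralNormalForm → GenusZeroValuesMzv`.
If `[r] − m ∈ KZ.relations` for some `m` in the closure of the MZV word representations, then
`eval m = r.value` by soundness of the calculus (`KZ.relations_le_ker_eval_holds`: relations
evaluate to zero). [Kontsevich–Zagier 2001, §1.2] [folklore] -/
theorem genusZeroValuesMzv_of_dihedralNormalForm
    (hNF : Summit.KontsevichZagierPeriods.KontsevichZagierPeriods.Theses.LinRedNormalForm.DihedralNormalForm) :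
    Summit.KontsevichZagierPeriods.KontsevichZagierPeriods.Theses.LinRedNormalForm.GenusZeroValuesMzv := by
  unfold Summit.KontsevichZagierPeriods.KontsevichZagierPeriods.Theses.LinRedNormalForm.GenusZeroValuesMzv
  intro k r p a b c hdom hint
  obtain ⟨m, hm, hrel⟩ := hNF k r p a b c hdom hint
  refine ⟨m, hm, ?_⟩
  have h0 : KZ.eval (KZ.of r - m) = 0 :=
    (AddMonoidHom.mem_ker).1 (KZ.relations_le_ker_eval_holds hrel)
  rw [map_sub, KZ.eval_of, sub_eq_zero] at h0
  exact h0.symm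

end Summit.KontsevichZagierPeriods.LinRedNormalForm
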